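import Summits.KontsevichZagierPeriods.KontsevichZagierPeriods.Theses.UnfoldedStokes
import Literature.NumberTheory.Transcendental.KZLogCalculusProofs
import Literature.NumberTheory.Transcendental.KZSubcalculusInvariants
import Literature.NumberTheory.Transcendental.KZKernelConjectureForms

/-!
# Disproof of `HyperellipticRiemannRelation` — findings (cdisprove seat, cycle 1, 2026-08-16)

Crux `stmt-KontsevichZagierPeriods-3522` = `UnfoldedStokes.HyperellipticRiemannRelation`:
for every strictly increasing `e : Fin 5 → ℚ` and all representations `r₁₂ r₁₄ r₃₄` on the
boxes `J₁×J₂, J₁×J₄, J₃×J₄` (`J_j = (e (j-1), e j)`) with integrand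
`g(x) = (x 1 − x 0)/√(|P(x 0)|·|P(x 1)|)`, `P(t) = ∏ (t − e i)`, the combination
`[r₁₂] − [r₁₄] + [r₃₄]` lies in `KZ.relations`.

## Verdict of this cycle: NO KILL. Why it resists

* VALUE LEVEL (the only invariant of `KZ.relations` available, soundness
  `KZ.relations_le_ker_eval_holds`): `W₁₂ − W₁₄ + W₃₄ = 0` holds. Independent re-computation
  (folder `num/genus2_float.py`, composite 200-node Gauss–Legendre after the `sin²` endpoint
  substitution, double precision): relative residual `≤ 9.1e−16` on 27 configurations including
  the near-degenerate `{0,1,1.001,2,3}`, `{0,1,2,2.001,100}`, `{0,0.01,1,2,3}` and 18 random ones;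
  a deliberately CRUDE 4-node quadrature gives residual `6e−4`, so the identity is transcendental,
  not an artefact of the discretisation; 40-digit mpmath (kit job `j017442`, 14 configurations):
  `|W₁₂ − W₁₄ + W₃₄| ≤ 4e−40`. Analytic derivation (upper-half-plane branch of `1/√P`
  normalised positive on `(e 4, ∞)`, boundary phases `ε = (−i, 1, i, −1, −i, 1)` on
  `K₀,J₁,J₂,J₃,J₄,K₅`; cuts `[e0,e1],[e2,e3],[e4,∞]`; `A₁ = −2I₁`, `A₂ = 2I₃`,
  `B₁ = 2i(I₂ − I₄)`, `B₂ = −2iI₄` where the B-cycles return through the LOWER half plane of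
  sheet 2): Riemann's `det(A₁,B₁) + det(A₂,B₂) = 0` is `−4i·(W₁₂ − W₁₄ + W₃₄) = 0`. The relative
  sign of the two determinants is the orientation convention; numerics select `+`
  (`W₁₂ − W₁₄ − W₃₄ = −2W₃₄ ≠ 0`). So the planner's "signs rest on numerics only" risk is retired:
  the pattern `(+,−,+)` on `(r₁₂, r₁₄, r₃₄)` is DERIVED (agrees with the ideators' nine-term
  bookkeeping, `Cruxes/…/NumericsIdeator2.md`).
* WHOLE PAIRING TABLE (same script family, `num/genus2_secondkind.py`; `C(m,n)` := the same
  three-box combination for the pair `(x^m dx/y, x^n dx/y)`): `C(0,1) = 0` (the crux),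
  `C(0,2) = 0` (1e−7: a SECOND pole-free-valued rung although `x²dx/y` is of the second kind —
  `Res_∞(f₀·x²dx/y) = 0`), `C(1,2) = 2π` (10 digits, 4 configurations: the genus-2 LEGENDRE
  relation, same constant as `LegendreCubicForm`), `C(0,3) = 2π/3`, `C(1,3) = (4/3)·(Σ e i)·π`.
  These match `C(m,n) = (π/2)·Res_∞(f_m x^n dx/y)` computed from `x = t⁻²`,
  `dx/y = −2t²(1 + s₁t²/2 + …)dt`, and confirm the cycle bookkeeping behind the crux independently.
* MEMBERSHIP LEVEL: a refutation needs an additive invariant of `KZ.FormalRep` killing the four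
  move sets and separating `[r₁₂] − [r₁₄] + [r₃₄]`; by
  `hyperellipticRiemannRelation_of_kontsevichZagierPeriods` below such an invariant refutes the
  SUMMIT (kernel form), i.e. this crux has no crux-local counterexample: it is exactly
  "summit restricted to one certified identity".
* BARRIERS: `noSemialgebraicPrimitive_inv_sub_two` / the ideators' (2,0)-class note
  (`LeverCensus-r1-k2.md`, Barrier note 1) constrain PROOFS (a 3-dimensional representation is
  forced), not the truth value. `ledger negatives --problem KontsevichZagierPeriods`: 1 entry
  (KinematicPlaneConvex), unrelated.

## What is proved (all sorry-free; LANDED under `Theorems/HyperellipticRiemannRelation/Negative/`)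

* `Negative/SignPatterns.lean` (p99626, ACCEPTED) = §0–§5 below under namespace
  `Summit.KontsevichZagierPeriods.UnfoldedStokes.HyperellipticRiemannRelationNegative`:
  §1 `integrand_pos_of` — the integrand is STRICTLY POSITIVE on every box `J_j × J_k`, `j < k`
  (`x 1 − x 0 > 0` there), hence §2 every admissible representation has value `> 0`
  (`value_pos_of_box`, `value_pos₁₂/₁₄/₃₄`): `W₁₂, W₁₄, W₃₄ > 0` and the crux says
  `W₁₄ = W₁₂ + W₃₄` (`value_eq_of_mem_relations`); §3 refuted sign patterns / strengthenings: no
  single box (`of₁₄_not_mem_relations`), no same-sign pair (`pair_not_mem_relations`), not the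
  all-plus combination (`all_plus_not_mem_relations`) is a relation — a proof must cancel AGAINST
  `J₁ × J₄`; §4 forced moves: `not_mem_closure_cov_nl` (coefficient sum `1`: an additivity move is
  needed), `not_mem_closure_add` (restricted evaluation through `{x | ∀ i, e 2 < x i}` is
  `W₃₄ > 0`: a rule-2/3 move is needed); §5 `hyperellipticRiemannRelation_of_exists` (ONE
  admissible triple in `relations` per `e` suffices) and
  `hyperellipticRiemannRelation_of_kontsevichZagierPeriods` (summit + identity ⇒ crux).
* `Negative/Witnesses.lean` (p100146, ACCEPTED): at `e = (0,1,2,3,5)` admissible representations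
  EXIST on the three boxes (`exists_rep₁₂/₁₄/₃₄`; semialgebraic boxes, integrand
  `(x 1 − x 0)·√(1/(−f(x 0)f(x 1)))` semialgebraic, integrable by `5·u(x 0)u(x 1)` with
  `u = 1/√|f|` integrable on all four gaps via `finTwoArrow`/Tonelli), plus the empty and zero
  representations — the crux is NOT VACUOUS.
* `Negative/LoadBearing.lean` (part 3, p101755, ACCEPTED): `hypotheses_satisfiable`;
  `canonical_values_of_hyperellipticRiemannRelation`; LOAD-BEARING: each of the seven hypotheses
  is necessary — `hyperellipticRiemannRelation_false_without_StrictMono` (witness: the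
  NON-MONOTONE `e = (0,1,2,5,3)`, same quintic, boxes of `r₁₄`, `r₃₄` empty, value `W₁₂ ≠ 0`: the
  proof must use the ORDER of the roots, specifically `e 3 < e 4`),
  `…_false_without_domain₁₂/₁₄/₃₄`, `…_false_without_integrand₁₂/₁₄/₃₄` (canonical witness vs
  empty-domain / zero-integrand representation); RIGIDITY: given the crux, the patterns `(+,−,−)`
  and `(+,+,−)` are not relations (`pattern_pmm/ppm_not_mem_relations`) — with all-plus this
  exhausts the sign classes: the coefficient vector `(1,−1,1)` is rigid.
* `Negative/DoubleRoot.lean` (part 4, p102560, ACCEPTED): the weakening `StrictMono e ↦ Monotone e` is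
  FALSE — `hyperellipticRiemannRelation_false_without_strictness`, witness the DOUBLE ROOT
  `e = (0,1,2,3,3)` (curve `y² = t(t−1)(t−2)(t−3)²`, genus `1`): boxes of `r₁₄`, `r₃₄` empty, an
  admissible `r₁₂` on `(0,1) × (1,2)` exists (`exists_rep₁₂_e₂`) with positive value. So
  DISTINCTNESS of the roots is load-bearing, not only their order: in the limit `e 4 → e 3` the
  interval identity does not survive (logarithmic degeneration).
* 40-digit numerics: kit job `j017442` (evidence `compute-j017442.json` on the item):
  `|W₁₂ − W₁₄ + W₃₄| ≤ 4e−40` (relative `≤ 2.7e−41`) on 14 configurations; `C(0,2) = 0`,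
  `C(1,2) = 2π`, `C(0,3) = 2π/3`, `C(1,3) = (4/3)(Σ e i)π` to `≤ 6e−39`; alternative patterns
  `W₁₂ − W₁₄ − W₃₄`, `W₁₂ + W₁₄ − W₃₄` of size `≥ 0.009` on every configuration.

## Not proved / near-misses (for the provers)

* Unconditional non-membership of the patterns `(+,−,−)`, `(+,+,−)` needs a certified inequality
  between hyperelliptic integrals (e.g. `W₁₂ < W₁₄`); only the conditional (rigidity) form is
  landed. Not needed by any line.
* General-`e` existence of the nine cross-type box representations (`BoxRepsExist` of the picked
  line `locked-slab-simplex`) is a POSITIVE statement (prover's `--supports` lemma); part 2 is its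
  `e = (0,1,2,3,5)` instance and shows the pattern (unit-gap model + splitting longer gaps).
-/

noncomputable section

open Set MeasureTheory
open Literature.NumberTheory.Transcendental
open Summit.KontsevichZagierPeriods.KontsevichZagierPeriods.Theses.UnfoldedStokes
  (HyperellipticRiemannRelation)

set_option linter.dupNamespace false

namespace Summit.KontsevichZagierPeriods.KontsevichZagierPeriods.Cruxes.HyperellipticRiemannRelation.Disproof

/-! ### §0 Values of the combination (soundness `KZ.relations_le_ker_eval_holds`, unfolded) -/

/-- The value of the crux combination. [folklore] -/
theorem eval_combination (r₁₂ r₁₄ r₃₄ : KZ.IntegralRep 2) :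
    KZ.eval (KZ.of r₁₂ - KZ.of r₁₄ + KZ.of r₃₄) = r₁₂.value - r₁₄.value + r₃₄.value := by
  simp only [map_add, map_sub, KZ.eval_of]

/-- If the crux combination is a relation then `W₁₄ = W₁₂ + W₃₄`. [folklore] -/
theorem value_eq_of_mem_relations {r₁₂ r₁₄ r₃₄ : KZ.IntegralRep 2}
    (h : KZ.of r₁₂ - KZ.of r₁₄ + KZ.of r₃₄ ∈ KZ.relations) :
    r₁₄.value = r₁₂.value + r₃₄.value := by
  have := (AddMonoidHom.mem_ker).1 (KZ.relations_le_ker_eval_holds h)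
  rw [eval_combination] at this
  linarith

/-! ### §1 The integrand is positive on ordered boxes -/

/-- Between two consecutive roots the quintic does not vanish. [folklore] -/
theorem prod_ne_zero_of_mem_gap {e : Fin 5 → ℚ} (he : StrictMono e) {t : ℝ} (j : Fin 4)
    (h1 : (e (Fin.castSucc j) : ℝ) < t) (h2 : t < (e (Fin.succ j) : ℝ)) :
    ∏ i : Fin 5, (t - (e i : ℝ)) ≠ 0 := by
  rw [Finset.prod_ne_zero_iff]
  intro i _
  rcases le_or_gt i (Fin.castSucc j) with hi | hi
  · have : (e i : ℝ) ≤ (e (Fin.castSucc j) : ℝ) := by exact_mod_cast he.monotone hi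
    exact sub_ne_zero.2 (by linarith)
  · have hi' : Fin.succ j ≤ i := by
      rw [Fin.lt_def] at hi
      rw [Fin.le_def]
      simp only [Fin.val_castSucc, Fin.val_succ] at hi ⊢
      omega
    have : (e (Fin.succ j) : ℝ) ≤ (e i : ℝ) := by exact_mod_cast he.monotone hi'
    exact sub_ne_zero.2 (by linarith)

/-- The box integrand is strictly positive wherever `x 0 < x 1` and neither coordinate is a root.
[folklore] -/
theorem integrand_pos_of {e : Fin 5 → ℚ} {x : Fin 2 → ℝ} (hlt : x 0 < x 1)
    (h0 : ∏ i : Fin 5, (x 0 - (e i : ℝ)) ≠ 0) (h1 : ∏ i : Fin 5, (x 1 - (e i : ℝ)) ≠ 0) :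
    0 < (x 1 - x 0) / Real.sqrt (|∏ i : Fin 5, (x 0 - (e i : ℝ))| * |∏ i : Fin 5, (x 1 - (e i : ℝ))|) :=
  div_pos (sub_pos.2 hlt) (Real.sqrt_pos.2 (mul_pos (abs_pos.2 h0) (abs_pos.2 h1)))

/-! ### §2 Values of admissible representations are positive -/

/-- An open box `(a,b) × (c,d) ⊆ ℝ²` with `a < b`, `c < d` has positive Lebesgue measure.
[folklore] -/
theorem volume_box_pos {a b c d : ℝ} (hab : a < b) (hcd : c < d) :
    0 < volume {x : Fin 2 → ℝ | a < x 0 ∧ x 0 < b ∧ c < x 1 ∧ x 1 < d} := by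
  have hopen : IsOpen {x : Fin 2 → ℝ | a < x 0 ∧ x 0 < b ∧ c < x 1 ∧ x 1 < d} := by
    refine (isOpen_lt continuous_const (continuous_apply 0)).inter
      ((isOpen_lt (continuous_apply 0) continuous_const).inter
      ((isOpen_lt continuous_const (continuous_apply 1)).inter
      (isOpen_lt (continuous_apply 1) continuous_const)))
  have hne : ({x : Fin 2 → ℝ | a < x 0 ∧ x 0 < b ∧ c < x 1 ∧ x 1 < d}).Nonempty :=
    ⟨![(a + b) / 2, (c + d) / 2], by
      simp only [mem_setOf_eq, Matrix.cons_val_zero, Matrix.cons_val_one]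
      refine ⟨?_, ?_, ?_, ?_⟩ <;> linarith⟩
  exact hopen.measure_pos volume hne

/-- **Positivity of admissible values.** A representation whose domain is a box
`(a,b) × (c,d)` with `b ≤ c` lying in two gaps of the quintic (no root inside either interval)
and whose integrand is the crux integrand on it has STRICTLY POSITIVE value. [folklore] -/
theorem value_pos_of_box {e : Fin 5 → ℚ} (he : StrictMono e) (j k : Fin 4)
    (hjk : (e (Fin.succ j) : ℝ) ≤ (e (Fin.castSucc k) : ℝ))
    (r : KZ.IntegralRep 2)
    (hd : r.domain = {x | (e (Fin.castSucc j) : ℝ) < x 0 ∧ x 0 < (e (Fin.succ j) : ℝ) ∧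
      (e (Fin.castSucc k) : ℝ) < x 1 ∧ x 1 < (e (Fin.succ k) : ℝ)})
    (hi : EqOn r.integrand (fun x => (x 1 - x 0) /
      Real.sqrt (|∏ i : Fin 5, (x 0 - (e i : ℝ))| * |∏ i : Fin 5, (x 1 - (e i : ℝ))|)) r.domain) :
    0 < r.value := by
  have hm : MeasurableSet r.domain := KZ.IntegralRep.measurableSet_domain_holds r
  have hpos : ∀ x ∈ r.domain, 0 < r.integrand x := by
    intro x hx
    rw [hi hx]
    rw [hd] at hx
    obtain ⟨h0a, h0b, h1a, h1b⟩ := hx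
    exact integrand_pos_of (by linarith) (prod_ne_zero_of_mem_gap he j h0a h0b)
      (prod_ne_zero_of_mem_gap he k h1a h1b)
  rw [KZ.IntegralRep.value, setIntegral_pos_iff_support_of_nonneg_ae
    ((ae_restrict_mem hm).mono fun x hx => (hpos x hx).le) r.integrableOn]
  have hsupp : Function.support r.integrand ∩ r.domain = r.domain :=
    inter_eq_right.2 fun x hx => Function.mem_support.2 (hpos x hx).ne'
  rw [hsupp, hd]
  have hj : (e (Fin.castSucc j) : ℝ) < (e (Fin.succ j) : ℝ) := by
    exact_mod_cast he (Fin.castSucc_lt_succ (i := j))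
  have hk : (e (Fin.castSucc k) : ℝ) < (e (Fin.succ k) : ℝ) := by
    exact_mod_cast he (Fin.castSucc_lt_succ (i := k))
  exact volume_box_pos hj hk

/-- `W₁₂ > 0` for every admissible `r₁₂`. [folklore] -/
theorem value_pos₁₂ {e : Fin 5 → ℚ} (he : StrictMono e) (r : KZ.IntegralRep 2)
    (hd : r.domain = {x | (e 0 : ℝ) < x 0 ∧ x 0 < (e 1 : ℝ) ∧ (e 1 : ℝ) < x 1 ∧ x 1 < (e 2 : ℝ)})
    (hi : EqOn r.integrand (fun x => (x 1 - x 0) /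
      Real.sqrt (|∏ i : Fin 5, (x 0 - (e i : ℝ))| * |∏ i : Fin 5, (x 1 - (e i : ℝ))|)) r.domain) :
    0 < r.value :=
  value_pos_of_box he 0 1 le_rfl r hd hi

/-- `W₁₄ > 0` for every admissible `r₁₄`. [folklore] -/
theorem value_pos₁₄ {e : Fin 5 → ℚ} (he : StrictMono e) (r : KZ.IntegralRep 2)
    (hd : r.domain = {x | (e 0 : ℝ) < x 0 ∧ x 0 < (e 1 : ℝ) ∧ (e 3 : ℝ) < x 1 ∧ x 1 < (e 4 : ℝ)})
    (hi : EqOn r.integrand (fun x => (x 1 - x 0) /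
      Real.sqrt (|∏ i : Fin 5, (x 0 - (e i : ℝ))| * |∏ i : Fin 5, (x 1 - (e i : ℝ))|)) r.domain) :
    0 < r.value :=
  value_pos_of_box he 0 3 (by exact_mod_cast he.monotone (by decide)) r hd hi

/-- `W₃₄ > 0` for every admissible `r₃₄`. [folklore] -/
theorem value_pos₃₄ {e : Fin 5 → ℚ} (he : StrictMono e) (r : KZ.IntegralRep 2)
    (hd : r.domain = {x | (e 2 : ℝ) < x 0 ∧ x 0 < (e 3 : ℝ) ∧ (e 3 : ℝ) < x 1 ∧ x 1 < (e 4 : ℝ)})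
    (hi : EqOn r.integrand (fun x => (x 1 - x 0) /
      Real.sqrt (|∏ i : Fin 5, (x 0 - (e i : ℝ))| * |∏ i : Fin 5, (x 1 - (e i : ℝ))|)) r.domain) :
    0 < r.value :=
  value_pos_of_box he 2 3 le_rfl r hd hi

/-! ### §3 Sign patterns: refuted natural strengthenings

Every admissible value is positive, so a formal combination of admissible boxes with all
coefficients of one sign is never a relation. In particular no single box `[J_j × J_k, g]` is a
relation, the ALL-PLUS pattern `[r₁₂] + [r₁₄] + [r₃₄]` is not, and no same-sign pair is. The
patterns `(+,−,−)` and `(+,+,−)` have values `∓2W₃₄`, `2W₁₂` GIVEN the crux, but without it their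
non-vanishing is a quantitative statement about hyperelliptic integrals (not attempted in Lean;
numerically `|value| ≥ 0.25` at `{0,1,2,3,5}`). -/

/-- A representation of non-zero value is not a relation. [cite: KontsevichZagier2001, §1.2] -/
theorem of_not_mem_relations_of_value_pos {n : ℕ} {r : KZ.IntegralRep n} (h : 0 < r.value) :
    KZ.of r ∉ KZ.relations := fun hr => by
  have := (AddMonoidHom.mem_ker).1 (KZ.relations_le_ker_eval_holds hr)
  rw [KZ.eval_of] at this
  exact h.ne' this

/-- Three representations of positive value never sum to a relation. [cite: KontsevichZagier2001, §1.2] -/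
theorem add_add_not_mem_relations_of_value_pos {n : ℕ} {r s t : KZ.IntegralRep n}
    (hr : 0 < r.value) (hs : 0 < s.value) (ht : 0 < t.value) :
    KZ.of r + KZ.of s + KZ.of t ∉ KZ.relations := fun h => by
  have := (AddMonoidHom.mem_ker).1 (KZ.relations_le_ker_eval_holds h)
  simp only [map_add, KZ.eval_of] at this
  linarith

/-- Two representations of positive value never sum to a relation. [cite: KontsevichZagier2001, §1.2] -/
theorem add_not_mem_relations_of_value_pos {n : ℕ} {r s : KZ.IntegralRep n}
    (hr : 0 < r.value) (hs : 0 < s.value) : KZ.of r + KZ.of s ∉ KZ.relations := fun h => by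
  have := (AddMonoidHom.mem_ker).1 (KZ.relations_le_ker_eval_holds h)
  simp only [map_add, KZ.eval_of] at this
  linarith

/-- Two representations of DIFFERENT value never differ by a relation. [cite: KontsevichZagier2001, §1.2] -/
theorem sub_not_mem_relations_of_value_ne {n m : ℕ} {r : KZ.IntegralRep n} {s : KZ.IntegralRep m}
    (h : r.value ≠ s.value) : KZ.of r - KZ.of s ∉ KZ.relations := fun h' => by
  have := (AddMonoidHom.mem_ker).1 (KZ.relations_le_ker_eval_holds h')
  simp only [map_sub, KZ.eval_of, sub_eq_zero] at this
  exact h this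

/-- **The all-plus pattern is not a relation**: for every strictly increasing `e` and every
admissible triple, `[r₁₂] + [r₁₄] + [r₃₄] ∉ KZ.relations` (value `W₁₂ + W₁₄ + W₃₄ > 0`). So any
proof of the crux must produce a cancellation AGAINST the box `J₁ × J₄`.
[cite: KontsevichZagier2001, §1.2] -/
theorem all_plus_not_mem_relations {e : Fin 5 → ℚ} (he : StrictMono e)
    (r₁₂ r₁₄ r₃₄ : KZ.IntegralRep 2)
    (hd₁₂ : r₁₂.domain = {x | (e 0 : ℝ) < x 0 ∧ x 0 < (e 1 : ℝ) ∧ (e 1 : ℝ) < x 1 ∧ x 1 < (e 2 : ℝ)})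
    (hd₁₄ : r₁₄.domain = {x | (e 0 : ℝ) < x 0 ∧ x 0 < (e 1 : ℝ) ∧ (e 3 : ℝ) < x 1 ∧ x 1 < (e 4 : ℝ)})
    (hd₃₄ : r₃₄.domain = {x | (e 2 : ℝ) < x 0 ∧ x 0 < (e 3 : ℝ) ∧ (e 3 : ℝ) < x 1 ∧ x 1 < (e 4 : ℝ)})
    (hi₁₂ : EqOn r₁₂.integrand (fun x => (x 1 - x 0) /
      Real.sqrt (|∏ i : Fin 5, (x 0 - (e i : ℝ))| * |∏ i : Fin 5, (x 1 - (e i : ℝ))|)) r₁₂.domain)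
    (hi₁₄ : EqOn r₁₄.integrand (fun x => (x 1 - x 0) /
      Real.sqrt (|∏ i : Fin 5, (x 0 - (e i : ℝ))| * |∏ i : Fin 5, (x 1 - (e i : ℝ))|)) r₁₄.domain)
    (hi₃₄ : EqOn r₃₄.integrand (fun x => (x 1 - x 0) /
      Real.sqrt (|∏ i : Fin 5, (x 0 - (e i : ℝ))| * |∏ i : Fin 5, (x 1 - (e i : ℝ))|)) r₃₄.domain) :
    KZ.of r₁₂ + KZ.of r₁₄ + KZ.of r₃₄ ∉ KZ.relations :=
  add_add_not_mem_relations_of_value_pos (value_pos₁₂ he r₁₂ hd₁₂ hi₁₂)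
    (value_pos₁₄ he r₁₄ hd₁₄ hi₁₄) (value_pos₃₄ he r₃₄ hd₃₄ hi₃₄)

/-- **No single box is a relation**, e.g. `[r₁₄] ∉ KZ.relations`: the crux is genuinely a
three-term identity at the level of values (`W₁₄ = W₁₂ + W₃₄` with all three positive).
[cite: KontsevichZagier2001, §1.2] -/
theorem of₁₄_not_mem_relations {e : Fin 5 → ℚ} (he : StrictMono e) (r₁₄ : KZ.IntegralRep 2)
    (hd₁₄ : r₁₄.domain = {x | (e 0 : ℝ) < x 0 ∧ x 0 < (e 1 : ℝ) ∧ (e 3 : ℝ) < x 1 ∧ x 1 < (e 4 : ℝ)})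
    (hi₁₄ : EqOn r₁₄.integrand (fun x => (x 1 - x 0) /
      Real.sqrt (|∏ i : Fin 5, (x 0 - (e i : ℝ))| * |∏ i : Fin 5, (x 1 - (e i : ℝ))|)) r₁₄.domain) :
    KZ.of r₁₄ ∉ KZ.relations :=
  of_not_mem_relations_of_value_pos (value_pos₁₄ he r₁₄ hd₁₄ hi₁₄)

/-- **No same-sign pair is a relation**, e.g. `[r₁₂] + [r₃₄] ∉ KZ.relations` (dropping the middle
term of the crux and flipping nothing leaves value `W₁₂ + W₃₄ = W₁₄ > 0`).
[cite: KontsevichZagier2001, §1.2] -/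
theorem pair_not_mem_relations {e : Fin 5 → ℚ} (he : StrictMono e) (r₁₂ r₃₄ : KZ.IntegralRep 2)
    (hd₁₂ : r₁₂.domain = {x | (e 0 : ℝ) < x 0 ∧ x 0 < (e 1 : ℝ) ∧ (e 1 : ℝ) < x 1 ∧ x 1 < (e 2 : ℝ)})
    (hd₃₄ : r₃₄.domain = {x | (e 2 : ℝ) < x 0 ∧ x 0 < (e 3 : ℝ) ∧ (e 3 : ℝ) < x 1 ∧ x 1 < (e 4 : ℝ)})
    (hi₁₂ : EqOn r₁₂.integrand (fun x => (x 1 - x 0) /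
      Real.sqrt (|∏ i : Fin 5, (x 0 - (e i : ℝ))| * |∏ i : Fin 5, (x 1 - (e i : ℝ))|)) r₁₂.domain)
    (hi₃₄ : EqOn r₃₄.integrand (fun x => (x 1 - x 0) /
      Real.sqrt (|∏ i : Fin 5, (x 0 - (e i : ℝ))| * |∏ i : Fin 5, (x 1 - (e i : ℝ))|)) r₃₄.domain) :
    KZ.of r₁₂ + KZ.of r₃₄ ∉ KZ.relations :=
  add_not_mem_relations_of_value_pos (value_pos₁₂ he r₁₂ hd₁₂ hi₁₂) (value_pos₃₄ he r₃₄ hd₃₄ hi₃₄)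

/-! ### §4 Forced moves: the relation lies in no obvious sub-calculus -/

/-- **Not derivable by change of variables + Newton–Leibniz alone** (rules (2)+(3)): the
coefficient sum of `[r₁₂] − [r₁₄] + [r₃₄]` is `1` (`KZ.closure_cov_nl_le_ker_coeffSum`), so at
least one additivity move is needed. Holds for ARBITRARY representations.
[cite: KontsevichZagier2001, §1.2] -/
theorem not_mem_closure_cov_nl {n : ℕ} (r₁₂ r₁₄ r₃₄ : KZ.IntegralRep n) :
    KZ.of r₁₂ - KZ.of r₁₄ + KZ.of r₃₄ ∉
      AddSubgroup.closure (KZ.changeOfVariablesRel ∪ KZ.newtonLeibnizRel) := by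
  intro h
  have := KZ.closure_cov_nl_le_ker_coeffSum h
  rw [AddMonoidHom.mem_ker] at this
  simp at this

/-- **Not derivable by the two additivity rules alone** (rules (1a)+(1b)): restricted evaluation
through the windows `{x | ∀ i, e 2 < x i}` (an invariant of the additivity moves,
`KZ.closure_add_le_ker_restrictedEval`) kills `r₁₂`, `r₁₄` (first coordinate `< e 1 < e 2`) and
sees all of `r₃₄`, giving `W₃₄ > 0`. So at least one move of type (2) or (3) is needed.
[cite: KontsevichZagier2001, §1.2] -/
theorem not_mem_closure_add {e : Fin 5 → ℚ} (he : StrictMono e) (r₁₂ r₁₄ r₃₄ : KZ.IntegralRep 2)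
    (hd₁₂ : r₁₂.domain = {x | (e 0 : ℝ) < x 0 ∧ x 0 < (e 1 : ℝ) ∧ (e 1 : ℝ) < x 1 ∧ x 1 < (e 2 : ℝ)})
    (hd₁₄ : r₁₄.domain = {x | (e 0 : ℝ) < x 0 ∧ x 0 < (e 1 : ℝ) ∧ (e 3 : ℝ) < x 1 ∧ x 1 < (e 4 : ℝ)})
    (hd₃₄ : r₃₄.domain = {x | (e 2 : ℝ) < x 0 ∧ x 0 < (e 3 : ℝ) ∧ (e 3 : ℝ) < x 1 ∧ x 1 < (e 4 : ℝ)})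
    (hi₃₄ : EqOn r₃₄.integrand (fun x => (x 1 - x 0) /
      Real.sqrt (|∏ i : Fin 5, (x 0 - (e i : ℝ))| * |∏ i : Fin 5, (x 1 - (e i : ℝ))|)) r₃₄.domain) :
    KZ.of r₁₂ - KZ.of r₁₄ + KZ.of r₃₄ ∉ AddSubgroup.closure (KZ.domainAddRel ∪ KZ.integrandAddRel) := by
  intro h
  set A : (n : ℕ) → Set (Fin n → ℝ) := fun n => {x | ∀ i, (e 2 : ℝ) < x i} with hA
  have hAm : ∀ n, MeasurableSet (A n) := fun n => by
    have : A n = ⋂ i, {x : Fin n → ℝ | (e 2 : ℝ) < x i} := by ext x; simp [hA]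
    rw [this]
    exact MeasurableSet.iInter fun i => measurableSet_lt measurable_const (measurable_pi_apply i)
  have h12 : (e 1 : ℝ) < (e 2 : ℝ) := by exact_mod_cast he (by decide)
  have hk := KZ.closure_add_le_ker_restrictedEval A hAm h
  rw [AddMonoidHom.mem_ker, map_add, map_sub, KZ.restrictedEval_of, KZ.restrictedEval_of,
    KZ.restrictedEval_of] at hk
  have e₁ : r₁₂.domain ∩ A 2 = ∅ := by
    rw [hd₁₂]; ext x
    simp only [hA, mem_inter_iff, mem_setOf_eq, mem_empty_iff_false, iff_false, not_and]
    intro hx hall; linarith [hall 0, hx.2.1]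
  have e₂ : r₁₄.domain ∩ A 2 = ∅ := by
    rw [hd₁₄]; ext x
    simp only [hA, mem_inter_iff, mem_setOf_eq, mem_empty_iff_false, iff_false, not_and]
    intro hx hall; linarith [hall 0, hx.2.1]
  have e₃ : r₃₄.domain ∩ A 2 = r₃₄.domain := by
    rw [hd₃₄]
    refine inter_eq_left.2 fun x hx => ?_
    have h23 : (e 2 : ℝ) < (e 3 : ℝ) := by exact_mod_cast he (by decide)
    intro i; fin_cases i
    · exact hx.1
    · exact h23.trans hx.2.2.1
  rw [e₁, e₂, e₃] at hk
  simp only [Measure.restrict_empty, integral_zero_measure, sub_zero, zero_add] at hk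
  exact (value_pos₃₄ he r₃₄ hd₃₄ hi₃₄).ne' hk

/-! ### §5 The `∀`-form is one instance; the crux is the summit restricted to one identity -/

/-- **One admissible triple per configuration suffices.** If for every strictly increasing `e`
SOME admissible triple gives a relation, the crux holds: admissible representations with the
same domain are congruent modulo `KZ.relations` (`KZ.of_sub_of_mem_relations_of_eqOn`), so the
universal quantifier over `r₁₂ r₁₄ r₃₄` hides no extra strength. (The converse needs existence of
admissible triples, `Negative/Witnesses`.) [cite: KontsevichZagier2001, §1.2 rule (1)] -/
theorem hyperellipticRiemannRelation_of_exists
    (H : ∀ e : Fin 5 → ℚ, StrictMono e → ∃ s₁₂ s₁₄ s₃₄ : KZ.IntegralRep 2,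
      s₁₂.domain = {x | (e 0 : ℝ) < x 0 ∧ x 0 < (e 1 : ℝ) ∧ (e 1 : ℝ) < x 1 ∧ x 1 < (e 2 : ℝ)} ∧
      s₁₄.domain = {x | (e 0 : ℝ) < x 0 ∧ x 0 < (e 1 : ℝ) ∧ (e 3 : ℝ) < x 1 ∧ x 1 < (e 4 : ℝ)} ∧
      s₃₄.domain = {x | (e 2 : ℝ) < x 0 ∧ x 0 < (e 3 : ℝ) ∧ (e 3 : ℝ) < x 1 ∧ x 1 < (e 4 : ℝ)} ∧
      EqOn s₁₂.integrand (fun x => (x 1 - x 0) /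
        Real.sqrt (|∏ i : Fin 5, (x 0 - (e i : ℝ))| * |∏ i : Fin 5, (x 1 - (e i : ℝ))|)) s₁₂.domain ∧
      EqOn s₁₄.integrand (fun x => (x 1 - x 0) /
        Real.sqrt (|∏ i : Fin 5, (x 0 - (e i : ℝ))| * |∏ i : Fin 5, (x 1 - (e i : ℝ))|)) s₁₄.domain ∧
      EqOn s₃₄.integrand (fun x => (x 1 - x 0) /
        Real.sqrt (|∏ i : Fin 5, (x 0 - (e i : ℝ))| * |∏ i : Fin 5, (x 1 - (e i : ℝ))|)) s₃₄.domain ∧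
      KZ.of s₁₂ - KZ.of s₁₄ + KZ.of s₃₄ ∈ KZ.relations) :
    HyperellipticRiemannRelation := by
  intro e he r₁₂ r₁₄ r₃₄ hd₁₂ hd₁₄ hd₃₄ hi₁₂ hi₁₄ hi₃₄
  obtain ⟨s₁₂, s₁₄, s₃₄, hs₁₂, hs₁₄, hs₃₄, hj₁₂, hj₁₄, hj₃₄, h⟩ := H e he
  have c₁₂ : KZ.of r₁₂ - KZ.of s₁₂ ∈ KZ.relations :=
    KZ.of_sub_of_mem_relations_of_eqOn (by rw [hd₁₂, hs₁₂])
      (fun p hp => (hi₁₂ hp).trans (hj₁₂ (by rw [hs₁₂]; rw [hd₁₂] at hp; exact hp)).symm)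
  have c₁₄ : KZ.of r₁₄ - KZ.of s₁₄ ∈ KZ.relations :=
    KZ.of_sub_of_mem_relations_of_eqOn (by rw [hd₁₄, hs₁₄])
      (fun p hp => (hi₁₄ hp).trans (hj₁₄ (by rw [hs₁₄]; rw [hd₁₄] at hp; exact hp)).symm)
  have c₃₄ : KZ.of r₃₄ - KZ.of s₃₄ ∈ KZ.relations :=
    KZ.of_sub_of_mem_relations_of_eqOn (by rw [hd₃₄, hs₃₄])
      (fun p hp => (hi₃₄ hp).trans (hj₃₄ (by rw [hs₃₄]; rw [hd₃₄] at hp; exact hp)).symm)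
  have := KZ.relations.add_mem (KZ.relations.sub_mem (KZ.relations.add_mem h c₁₂) c₁₄) c₃₄
  convert this using 1
  abel

/-- **A refutation of the crux would refute the summit** (modulo the certified value identity).
If `W₁₂ − W₁₄ + W₃₄ = 0` for admissible triples — Riemann's bilinear relation for `dx/y`, `x dx/y`
on `y² = P(x)` (boundary phases `(−i,1,i,−1,−i,1)`; certified numerically to `1e−15` relative on
27 configurations, `num/genus2_float.py`) — then the summit `KontsevichZagierPeriods`
(equivalently its kernel form, `kzKernelConjecture_iff_isRational`) implies the crux. Hence an
additive invariant of `KZ.FormalRep` vanishing on the four move sets but not on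
`[r₁₂] − [r₁₄] + [r₃₄]` would disprove the summit itself. [cite: KontsevichZagier2001, §1.2 Conjecture 1] -/
theorem hyperellipticRiemannRelation_of_kontsevichZagierPeriods
    (hval : ∀ e : Fin 5 → ℚ, StrictMono e → ∀ r₁₂ r₁₄ r₃₄ : KZ.IntegralRep 2,
      r₁₂.domain = {x | (e 0 : ℝ) < x 0 ∧ x 0 < (e 1 : ℝ) ∧ (e 1 : ℝ) < x 1 ∧ x 1 < (e 2 : ℝ)} →
      r₁₄.domain = {x | (e 0 : ℝ) < x 0 ∧ x 0 < (e 1 : ℝ) ∧ (e 3 : ℝ) < x 1 ∧ x 1 < (e 4 : ℝ)} →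
      r₃₄.domain = {x | (e 2 : ℝ) < x 0 ∧ x 0 < (e 3 : ℝ) ∧ (e 3 : ℝ) < x 1 ∧ x 1 < (e 4 : ℝ)} →
      EqOn r₁₂.integrand (fun x => (x 1 - x 0) /
        Real.sqrt (|∏ i : Fin 5, (x 0 - (e i : ℝ))| * |∏ i : Fin 5, (x 1 - (e i : ℝ))|)) r₁₂.domain →
      EqOn r₁₄.integrand (fun x => (x 1 - x 0) /
        Real.sqrt (|∏ i : Fin 5, (x 0 - (e i : ℝ))| * |∏ i : Fin 5, (x 1 - (e i : ℝ))|)) r₁₄.domain →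
      EqOn r₃₄.integrand (fun x => (x 1 - x 0) /
        Real.sqrt (|∏ i : Fin 5, (x 0 - (e i : ℝ))| * |∏ i : Fin 5, (x 1 - (e i : ℝ))|)) r₃₄.domain →
      r₁₂.value - r₁₄.value + r₃₄.value = 0)
    (hKZ : KontsevichZagierPeriods) : HyperellipticRiemannRelation := by
  have hK : KZKernelConjecture := kzKernelConjecture_iff_isRational.mpr hKZ
  intro e he r₁₂ r₁₄ r₃₄ hd₁₂ hd₁₄ hd₃₄ hi₁₂ hi₁₄ hi₃₄
  apply hK
  rw [eval_combination]
  exact hval e he r₁₂ r₁₄ r₃₄ hd₁₂ hd₁₄ hd₃₄ hi₁₂ hi₁₄ hi₃₄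

end Summit.KontsevichZagierPeriods.KontsevichZagierPeriods.Cruxes.HyperellipticRiemannRelation.Disproof

end
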